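import Literature.MathematicalPhysics.QuantumFieldTheory.Balaban1983to89.StrongCouplingOpenWindow
import Literature.MathematicalPhysics.QuantumFieldTheory.Balaban1983to89.T4GibbsTilted
import Literature.Probability.TransportMaps.DobrushinCouplingGibbsContinuous
import Literature.Probability.TransportMaps.DobrushinCouplingTV
import HarnessLib
/-!
# Dobrushin couplings for two tilted Haar product laws (`weightMeasure`) from one-link
# Kantorovich–Rubinstein bounds on their one-link laws (`siteLaw (weightSpec ·)`), with the
# bad-set ∕ decay forms (Thm. 11.5.4.1 / Cor. 11.5.4.2) and the total-variation currency

[topic MathematicalPhysics/QuantumFieldTheory]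

Three parts, one namespace (`StrongCouplingOpenWindow`, as the directory's tilted-Haar files). PART I:
Cor. 3.2.2.2 for `weightMeasure φ`, `weightMeasure φ'` from one-link Kantorovich–Rubinstein bounds. PART II
(second sectioning docstring): Thm. 11.5.4.1 / Cor. 11.5.4.2 (bad sets, decay, comparison of
expectations). PART III (third sectioning docstring): the same in total-variation currency from one-link
ENERGY OSCILLATION rows.

The lattice-gauge files of this directory phrase finite-volume Gibbs laws as TILTED Haar product
measures: `StrongCouplingOpenWindow.weightMeasure φ = (⊗_{e ∈ V} Haar).tilted φ` with weight
specification `weightSpec φ` and one-link laws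
`siteLaw (weightSpec φ) e ω = Haar.tilted (g ↦ φ(ω^{e ← g}))` (`siteLaw_weightSpec_eq_tilted`),
while Presutti's coupling theorems are proved for `gibbsMeasure` / `gibbsKernel` of
`T4DobrushinTensorisation` §7. By `T4GibbsTilted` these are the same objects with `A = −φ`
(`weightMeasure_eq_gibbsMeasure`, `siteLaw_weightSpec_eq_gibbsKernel`). Consequently, for two
CONTINUOUS energies `φ, φ'` on `V → G` (`V` a finite link set, `G` a compact metric group — e.g.
`SU(N)` with any metric inducing its topology), Presutti's Corollary 3.2.2.2 holds for the pair
`weightMeasure φ, weightMeasure φ'` with the one-link input given POINTWISE (some coupling of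
`siteLaw (weightSpec φ) e ω`, `siteLaw (weightSpec φ') e ω'` of cost `≤ C_e + Σ_{y ≠ e} r(e,y) d_y(ω_y, ω'_y)`)
or in DUAL Kantorovich–Rubinstein form (the same bound for
`∫ ψ d(siteLaw (weightSpec φ) e ω) − ∫ ψ d(siteLaw (weightSpec φ') e ω')`, all `ψ` with
`|ψ a − ψ b| ≤ d_e(a, b)` — the currency of `DobrushinMetric.IsKRContraction.contract`):
`Presutti2009_cor_3_2_2_2_weightMeasure`, `Presutti2009_cor_3_2_2_2_weightMeasure_of_dual`. The
measurable one-link couplings are produced inside (`DobrushinCouplingGibbsContinuous`).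

Scope (honest): finite link sets, continuous energies, compact metric structure group; the one-link
bounds are hypotheses (for a model they are its Dobrushin rows plus, for `φ ≠ φ'`, the one-link
distance between the two specifications at equal boundary condition).

## References
* E. Presutti, *Scaling Limits in Statistical Mechanics and Microstructures in Continuum
  Mechanics* (Springer 2009), §3.2.2 Thm. 3.2.2.1, Cor. 3.2.2.2 (pp. 113–115). [Presutti2009]
* S. Friedli, Y. Velenik, *Statistical Mechanics of Lattice Systems* (2017), §6.10.2 (6.110)
  (Gibbsian specification relative to a reference measure). [FriedliVelenik2017]
-/

noncomputable section

open MeasureTheory ProbabilityTheory Function Finset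
open scoped ENNReal NNReal BoundedContinuousFunction
open Literature.Probability.LatticeModels
open Literature.Probability.LatticeModels.DobrushinMetric

namespace Literature.MathematicalPhysics.QuantumFieldTheory.Balaban1983to89.StrongCouplingOpenWindow

open Literature.MathematicalPhysics.QuantumFieldTheory
open Literature.MeasureTheory.OptimalTransport (IsCoupling)
open Literature.MathematicalPhysics.QuantumFieldTheory.Balaban1983to89.T4DobrushinTensorisation
  (gibbsMeasure gibbsKernel gibbsMeasure_neg_eq_tilted gibbsKernel_neg_eq_tilted)
open Literature.Probability.TransportMaps.DobrushinCouplingGibbsContinuous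

section Bridge

variable {V : Type*} [Fintype V] [DecidableEq V] {G : Type*} [Group G] [TopologicalSpace G]
  [IsTopologicalGroup G] [CompactSpace G] [MeasurableSpace G] [BorelSpace G]

omit [DecidableEq V] in
/-- **The weight measure is the T4 Gibbs law of `−φ`**: `weightMeasure φ = gibbsMeasure (⊗ Haar) (−φ)`.
[cite: FriedliVelenik2017, §6.10.2 (6.110)] -/
theorem weightMeasure_eq_gibbsMeasure (φ : (V → G) → ℝ) :
    weightMeasure φ =
      gibbsMeasure (E := fun _ : V => G) (fun _ => haarProbability G) (fun U => -φ U) := by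
  rw [gibbsMeasure_neg_eq_tilted]
  rfl

omit [Fintype V] in
/-- **The one-link law of the weight specification is the T4 one-site Gibbs kernel of `−φ`**:
`siteLaw (weightSpec φ) e ω = gibbsKernel (⊗ Haar) (−φ) e ω`. [cite: FriedliVelenik2017, §6.10.2 (6.110)] -/
theorem siteLaw_weightSpec_eq_gibbsKernel [SecondCountableTopology G] {φ : (V → G) → ℝ}
    (hφm : Measurable φ) (e : V) (ω : V → G) :
    siteLaw (weightSpec φ) e ω =
      gibbsKernel (E := fun _ : V => G) (fun _ => haarProbability G) (fun U => -φ U) e ω := by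
  rw [siteLaw_weightSpec_eq_tilted hφm,
    gibbsKernel_neg_eq_tilted (π := fun _ : V => haarProbability G) hφm]

end Bridge

section Coupling

variable {V : Type*} [Fintype V] [DecidableEq V] [Nonempty V] {G : Type*} [Group G] [MetricSpace G]
  [IsTopologicalGroup G] [CompactSpace G] [MeasurableSpace G] [BorelSpace G]

/-- **Presutti 2009, Corollary 3.2.2.2, for two tilted Haar product laws from POINTWISE one-link
bounds.** `V` a finite set of links, `G` a compact metric group, `φ, φ'` continuous energies;
bounded continuous link costs `d_e ≥ 0`; if at every pair `(ω, ω')` some coupling of the one-link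
laws `siteLaw (weightSpec φ) e ω`, `siteLaw (weightSpec φ') e ω'` has
`∫ d_e ≤ C_e + Σ_{y ≠ e} r(e,y) d_y(ω_y, ω'_y)`, then some coupling `Q` of `weightMeasure φ`,
`weightMeasure φ'` has `v_e ≤ C_e + Σ_{y ≠ e} r(e,y) v_y`, `v_e = ∫ d_e(U_e, U'_e) dQ`.
[cite: Presutti2009, §3.2.2 Cor. 3.2.2.2] -/
theorem Presutti2009_cor_3_2_2_2_weightMeasure {φ φ' : (V → G) → ℝ} (hφc : Continuous φ)
    (hφ'c : Continuous φ') (d : V → (G × G) →ᵇ ℝ≥0) (C : V → ℝ≥0) (r : V → V → ℝ≥0)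
    (hK : ∀ e (p : (V → G) × (V → G)), ∃ π : Measure (G × G), IsProbabilityMeasure π ∧
      IsCoupling (siteLaw (weightSpec φ) e p.1) (siteLaw (weightSpec φ') e p.2) π ∧
      ∫⁻ s, (d e s : ℝ≥0∞) ∂π ≤ C e + ∑ y ∈ univ.erase e, (r e y : ℝ≥0∞) * d y (p.1 y, p.2 y)) :
    ∃ Q : Measure ((V → G) × (V → G)), IsProbabilityMeasure Q ∧
      IsCoupling (weightMeasure φ) (weightMeasure φ') Q ∧
      ∀ e, ∫⁻ x, (d e (x.1 e, x.2 e) : ℝ≥0∞) ∂Q ≤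
        C e + ∑ y ∈ univ.erase e, (r e y : ℝ≥0∞) * ∫⁻ x, (d y (x.1 y, x.2 y) : ℝ≥0∞) ∂Q := by
  obtain ⟨a, ha⟩ := exists_abs_le_of_continuous hφc
  obtain ⟨a', ha'⟩ := exists_abs_le_of_continuous hφ'c
  have hφm : Measurable φ := hφc.measurable
  have hφ'm : Measurable φ' := hφ'c.measurable
  have hm : Measurable fun U : V → G => -φ U := hφm.neg
  have hm' : Measurable fun U : V → G => -φ' U := hφ'm.neg
  have hc : Continuous fun U : V → G => -φ U := hφc.neg
  have hc' : Continuous fun U : V → G => -φ' U := hφ'c.neg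
  rw [weightMeasure_eq_gibbsMeasure φ, weightMeasure_eq_gibbsMeasure φ']
  refine Presutti2009_cor_3_2_2_2_gibbs_continuous (haarProbability G) (A := fun U => -φ U)
    (A' := fun U => -φ' U) hm hc (a := a) (fun U => by simpa [abs_neg] using ha U) hm' hc'
    (a' := a') (fun U => by simpa [abs_neg] using ha' U) d C r fun e p => ?_
  rw [← siteLaw_weightSpec_eq_gibbsKernel hφm, ← siteLaw_weightSpec_eq_gibbsKernel hφ'm]
  exact hK e p

/-- **The same from DUAL (Kantorovich–Rubinstein) one-link bounds**: if every `d_e` is a continuous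
pseudo-metric on `G` and for all `ψ` with `|ψ a − ψ b| ≤ d_e(a, b)`,
`∫ ψ d(siteLaw (weightSpec φ) e ω) − ∫ ψ d(siteLaw (weightSpec φ') e ω') ≤ C_e + Σ_{y ≠ e} r(e,y) d_y(ω_y, ω'_y)`
(the Lipschitz-observable currency of `IsKRContraction.contract`), then the same conclusion holds.
[cite: Presutti2009, §3.2.2 Cor. 3.2.2.2] -/
theorem Presutti2009_cor_3_2_2_2_weightMeasure_of_dual {φ φ' : (V → G) → ℝ} (hφc : Continuous φ)
    (hφ'c : Continuous φ') (d : V → (G × G) →ᵇ ℝ≥0) (hd0 : ∀ e g, d e (g, g) = 0)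
    (hdsymm : ∀ e g h, d e (g, h) = d e (h, g))
    (hdtri : ∀ e g h k, d e (g, k) ≤ d e (g, h) + d e (h, k)) (C : V → ℝ≥0) (r : V → V → ℝ≥0)
    (hdual : ∀ e (p : (V → G) × (V → G)) (ψ : G → ℝ), Continuous ψ →
      (∀ g h, |ψ g - ψ h| ≤ d e (g, h)) →
      ∫ g, ψ g ∂(siteLaw (weightSpec φ) e p.1) - ∫ g, ψ g ∂(siteLaw (weightSpec φ') e p.2) ≤
        (C e : ℝ) + ∑ y ∈ univ.erase e, (r e y : ℝ) * d y (p.1 y, p.2 y)) :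
    ∃ Q : Measure ((V → G) × (V → G)), IsProbabilityMeasure Q ∧
      IsCoupling (weightMeasure φ) (weightMeasure φ') Q ∧
      ∀ e, ∫⁻ x, (d e (x.1 e, x.2 e) : ℝ≥0∞) ∂Q ≤
        C e + ∑ y ∈ univ.erase e, (r e y : ℝ≥0∞) * ∫⁻ x, (d y (x.1 y, x.2 y) : ℝ≥0∞) ∂Q := by
  obtain ⟨a, ha⟩ := exists_abs_le_of_continuous hφc
  obtain ⟨a', ha'⟩ := exists_abs_le_of_continuous hφ'c
  have hφm : Measurable φ := hφc.measurable
  have hφ'm : Measurable φ' := hφ'c.measurable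
  have hm : Measurable fun U : V → G => -φ U := hφm.neg
  have hm' : Measurable fun U : V → G => -φ' U := hφ'm.neg
  have hc : Continuous fun U : V → G => -φ U := hφc.neg
  have hc' : Continuous fun U : V → G => -φ' U := hφ'c.neg
  rw [weightMeasure_eq_gibbsMeasure φ, weightMeasure_eq_gibbsMeasure φ']
  refine Presutti2009_cor_3_2_2_2_gibbs_continuous_of_dual (haarProbability G) (A := fun U => -φ U)
    (A' := fun U => -φ' U) hm hc (a := a) (fun U => by simpa [abs_neg] using ha U) hm' hc'
    (a' := a') (fun U => by simpa [abs_neg] using ha' U) d hd0 hdsymm hdtri C r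
    fun e p ψ hψ hL => ?_
  rw [← siteLaw_weightSpec_eq_gibbsKernel hφm, ← siteLaw_weightSpec_eq_gibbsKernel hφ'm]
  exact hdual e p ψ hψ hL

end Coupling

end Literature.MathematicalPhysics.QuantumFieldTheory.Balaban1983to89.StrongCouplingOpenWindow

end

/-!
# Part II — Presutti's generalized Dobrushin theorem (Thm. 11.5.4.1 / Cor. 11.5.4.2) for two tilted
# Haar product laws `weightMeasure φ`, `weightMeasure φ'` from one-link bounds on `siteLaw (weightSpec ·)`

Companion of Part I (Cor. 3.2.2.2 on these objects). Here the
measure-level conclusions of Presutti's §11.5 — exponential decay of the link discrepancies of the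
coupling away from the links that carry constants, and the resulting comparison of expectations —
are stated for the objects of this directory: `V` a finite set of links, `G` a compact metric group
(e.g. `SU(N)`), `φ, φ'` CONTINUOUS energies, `weightMeasure φ = (⊗ Haar).tilted φ`, one-link laws
`siteLaw (weightSpec φ) e ω`. The one-link input (Presutti's (11.5.6.7): the Vaserstein/Lipschitz
condition off the bad sets plus the bad-set indicator terms, here continuous cut-offs
`χ_e, χ'_e ≥ 0`) is taken either POINTWISE (some coupling of `siteLaw (weightSpec φ) e ω`,
`siteLaw (weightSpec φ') e ω'` with `∫ d_e ≤ c_e + Σ_{y ≠ e} θ(e,y) d_y(ω_y, ω'_y) + χ_e(ω) + χ'_e(ω')`)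
or in DUAL Kantorovich–Rubinstein form (the same bound for
`∫ ψ d(siteLaw (weightSpec φ) e ω) − ∫ ψ d(siteLaw (weightSpec φ') e ω')`, all `ψ` with
`|ψ a − ψ b| ≤ d_e(a, b)` — the currency of `DobrushinMetric.IsKRContraction.contract`):

* `exists_isCoupling_le_of_defects_weightMeasure` (and `…_of_dual`) — Cor. 3.2.2.2 with the
  bad-set terms, ONE call: a coupling `Q` with `v_e ≤ c_e + Σ_{y ≠ e} r(e,y) v_y + ⟨χ_e⟩_φ + ⟨χ'_e⟩_φ'`;
* `Presutti2009_thm_11_5_4_1_weightMeasure` — link level: under (11.5.4.1)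
  `Σ_{y ≠ e} θ(e,y) e^{δ(e,y)} ≤ ρ < 1` there is a coupling `Q` of `weightMeasure φ`,
  `weightMeasure φ'` with `E_Q d_e(U_e, U'_e) ≤ (1 − ρ)⁻¹ max_k e^{−δ(e,k)} (c_k + ⟨χ_k⟩_φ + ⟨χ'_k⟩_φ')`;
* `Presutti2009_cor_11_5_4_2_weightMeasure` (and `…_of_dual`) — (11.5.4.3): with the constants
  concentrated near a set `B` of «boundary» links, `c_k ≤ D Σ_{j ∈ B} e^{−δ(k,j)}`, and bad-set
  means `≤ E`, every bounded measurable `f` with `|f(U) − f(U')| ≤ Σ_e L_e d_e(U_e, U'_e)` has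
  `|∫ f d(weightMeasure φ) − ∫ f d(weightMeasure φ')| ≤ Σ_e L_e (1 − ρ)⁻¹ (D Σ_{j ∈ B} e^{−δ(e,j)} + E)`;
* `Presutti2009_thm_11_5_4_1_sites_weightMeasure` (and `…_of_dual`) — two scales: links grouped
  into blocks `b : V → ι` with Presutti's block parameters (11.5.3.8)–(11.5.3.9).

All proofs are transports along `weightMeasure_eq_gibbsMeasure` /
`siteLaw_weightSpec_eq_gibbsKernel` (`WeightSpecDobrushinCoupling`, via `T4GibbsTilted`) of the
corresponding statements of `DobrushinCouplingGibbsContinuous.lean`, Part II (bad sets ∕ decay).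

Scope (honest): finite link sets, continuous energies, compact metric structure group; the one-link
rows off the bad sets, the bad-set rarity, (11.5.4.1) and the block parameters are HYPOTHESES;
continuous spins keep the additive bad-set term `E` (no `d ≥ 1` absorption). Nothing here is a
statement about a specific lattice gauge model.

## References
* E. Presutti, *Scaling Limits in Statistical Mechanics and Microstructures in Continuum
  Mechanics* (Springer 2009), §11.5.4 Thm. 11.5.4.1, Cor. 11.5.4.2 (p. 386); §11.5.6
  (11.5.6.7)–(11.5.6.11) and «Conclusions» (p. 391). [Presutti2009]
* S. Friedli, Y. Velenik, *Statistical Mechanics of Lattice Systems* (2017), §6.10.2 (6.110).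
  [FriedliVelenik2017]
-/

noncomputable section

open MeasureTheory ProbabilityTheory Function Finset
open scoped ENNReal NNReal BoundedContinuousFunction
open Literature.Probability.LatticeModels
open Literature.Probability.LatticeModels.DobrushinMetric

namespace Literature.MathematicalPhysics.QuantumFieldTheory.Balaban1983to89.StrongCouplingOpenWindow

open Literature.MathematicalPhysics.QuantumFieldTheory
open Literature.MeasureTheory.OptimalTransport (IsCoupling)
open Literature.MathematicalPhysics.QuantumFieldTheory.Balaban1983to89.T4DobrushinTensorisation
  (gibbsMeasure gibbsKernel isMarkovKernel_gibbsKernel isProbabilityMeasure_gibbsMeasure)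
open Literature.Probability.TransportMaps.DobrushinCouplingCompact (exists_isCoupling_le_of_defects)
open Literature.Probability.TransportMaps.DobrushinCouplingGibbsContinuous

/-! ### Defects form of Cor. 3.2.2.2 (one call: pointwise or dual one-link rows with cut-offs) -/

section Defects

variable {V : Type*} [Fintype V] [DecidableEq V] [Nonempty V] {G : Type*} [Group G] [MetricSpace G]
  [IsTopologicalGroup G] [CompactSpace G] [MeasurableSpace G] [BorelSpace G]

/-- **Presutti 2009, Corollary 3.2.2.2 with the bad-set terms of (11.5.6.7)–(11.5.6.8), for two
tilted Haar product laws, from POINTWISE one-link bounds** («the bad sets cost only their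
probabilities»): `φ, φ'` continuous energies on `V → G`; bounded continuous link costs `d_e ≥ 0` and
cut-offs `χ_e, χ'_e ≥ 0`; if at every pair `(ω, ω')` some coupling of `siteLaw (weightSpec φ) e ω`,
`siteLaw (weightSpec φ') e ω'` has `∫ d_e ≤ c_e + Σ_{y ≠ e} r(e,y) d_y(ω_y, ω'_y) + χ_e(ω) + χ'_e(ω')`,
then some coupling `Q` of `weightMeasure φ`, `weightMeasure φ'` has
`v_e ≤ c_e + Σ_{y ≠ e} r(e,y) v_y + ∫ χ_e d(weightMeasure φ) + ∫ χ'_e d(weightMeasure φ')`,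
`v_e = ∫ d_e(U_e, U'_e) dQ`. The measurable one-link couplings are selected inside
(`exists_oneSiteKernels_gibbs_of_continuous_defects`).
[cite: Presutti2009, §3.2.2 Cor. 3.2.2.2 with §11.5.6 (11.5.6.7)–(11.5.6.8)] -/
theorem exists_isCoupling_le_of_defects_weightMeasure {φ φ' : (V → G) → ℝ} (hφc : Continuous φ)
    (hφ'c : Continuous φ') (d : V → (G × G) →ᵇ ℝ≥0) (c : V → ℝ≥0) (r : V → V → ℝ≥0)
    (χ χ' : V → (V → G) →ᵇ ℝ≥0)
    (hK : ∀ e (p : (V → G) × (V → G)), ∃ π : Measure (G × G), IsProbabilityMeasure π ∧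
      IsCoupling (siteLaw (weightSpec φ) e p.1) (siteLaw (weightSpec φ') e p.2) π ∧
      ∫⁻ s, (d e s : ℝ≥0∞) ∂π ≤
        c e + ∑ y ∈ univ.erase e, (r e y : ℝ≥0∞) * d y (p.1 y, p.2 y) + χ e p.1 + χ' e p.2) :
    ∃ Q : Measure ((V → G) × (V → G)), IsProbabilityMeasure Q ∧
      IsCoupling (weightMeasure φ) (weightMeasure φ') Q ∧
      ∀ e, ∫⁻ x, (d e (x.1 e, x.2 e) : ℝ≥0∞) ∂Q ≤
        c e + ∑ y ∈ univ.erase e, (r e y : ℝ≥0∞) * ∫⁻ x, (d y (x.1 y, x.2 y) : ℝ≥0∞) ∂Q +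
          ∫⁻ ω, (χ e ω : ℝ≥0∞) ∂(weightMeasure φ) + ∫⁻ ω', (χ' e ω' : ℝ≥0∞) ∂(weightMeasure φ') := by
  obtain ⟨a, ha⟩ := exists_abs_le_of_continuous hφc
  obtain ⟨a', ha'⟩ := exists_abs_le_of_continuous hφ'c
  have hφm : Measurable φ := hφc.measurable
  have hφ'm : Measurable φ' := hφ'c.measurable
  have hm : Measurable fun U : V → G => -φ U := hφm.neg
  have hm' : Measurable fun U : V → G => -φ' U := hφ'm.neg
  have hc : Continuous fun U : V → G => -φ U := hφc.neg
  have hc' : Continuous fun U : V → G => -φ' U := hφ'c.neg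
  have hb : ∀ U : V → G, |(fun U => -φ U) U| ≤ a := fun U => by simpa [abs_neg] using ha U
  have hb' : ∀ U : V → G, |(fun U => -φ' U) U| ≤ a' := fun U => by simpa [abs_neg] using ha' U
  rw [weightMeasure_eq_gibbsMeasure φ, weightMeasure_eq_gibbsMeasure φ']
  haveI := fun e => isMarkovKernel_gibbsKernel (π := fun _ : V => haarProbability G) hm hb e
  haveI := fun e => isMarkovKernel_gibbsKernel (π := fun _ : V => haarProbability G) hm' hb' e
  haveI := isProbabilityMeasure_gibbsMeasure (π := fun _ : V => haarProbability G) hm hb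
  haveI := isProbabilityMeasure_gibbsMeasure (π := fun _ : V => haarProbability G) hm' hb'
  have hK' : ∀ e (p : (V → G) × (V → G)), ∃ π : Measure (G × G), IsProbabilityMeasure π ∧
      IsCoupling (gibbsKernel (E := fun _ : V => G) (fun _ => haarProbability G) (fun U => -φ U) e p.1)
        (gibbsKernel (E := fun _ : V => G) (fun _ => haarProbability G) (fun U => -φ' U) e p.2) π ∧
      ∫⁻ s, (d e s : ℝ≥0∞) ∂π ≤
        c e + ∑ y ∈ univ.erase e, (r e y : ℝ≥0∞) * d y (p.1 y, p.2 y) + χ e p.1 + χ' e p.2 := by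
    intro e p
    rw [← siteLaw_weightSpec_eq_gibbsKernel hφm, ← siteLaw_weightSpec_eq_gibbsKernel hφ'm]
    exact hK e p
  obtain ⟨q, hq, h, hqb⟩ := exists_oneSiteKernels_gibbs_of_continuous_defects (haarProbability G)
    hm hc hb hm' hc' hb' d c r χ χ' hK'
  exact exists_isCoupling_le_of_defects h d c r χ χ' hqb

/-- **The same from DUAL (Kantorovich–Rubinstein) one-link rows with cut-offs**: every `d_e` a
continuous pseudo-metric on `G` and, for all `ψ` with `|ψ g − ψ h| ≤ d_e(g, h)`,
`∫ ψ d(siteLaw (weightSpec φ) e ω) − ∫ ψ d(siteLaw (weightSpec φ') e ω') ≤ c_e + Σ_{y ≠ e} r(e,y) d_y(ω_y, ω'_y) + χ_e(ω) + χ'_e(ω')`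
(the `IsKRContraction.contract` currency off the bad sets plus the bad-set terms) ⟹ a coupling `Q`
of `weightMeasure φ`, `weightMeasure φ'` with
`v_e ≤ c_e + Σ_{y ≠ e} r(e,y) v_y + ∫ χ_e d(weightMeasure φ) + ∫ χ'_e d(weightMeasure φ')`.
[cite: Presutti2009, §3.2.2 Cor. 3.2.2.2 with §11.5.6 (11.5.6.7)–(11.5.6.8)] -/
theorem exists_isCoupling_le_of_defects_weightMeasure_of_dual {φ φ' : (V → G) → ℝ}
    (hφc : Continuous φ) (hφ'c : Continuous φ') (d : V → (G × G) →ᵇ ℝ≥0)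
    (hd0 : ∀ e g, d e (g, g) = 0) (hdsymm : ∀ e g h, d e (g, h) = d e (h, g))
    (hdtri : ∀ e g h k, d e (g, k) ≤ d e (g, h) + d e (h, k)) (c : V → ℝ≥0) (r : V → V → ℝ≥0)
    (χ χ' : V → (V → G) →ᵇ ℝ≥0)
    (hdual : ∀ e (p : (V → G) × (V → G)) (ψ : G → ℝ), Continuous ψ →
      (∀ g h, |ψ g - ψ h| ≤ d e (g, h)) →
      ∫ g, ψ g ∂(siteLaw (weightSpec φ) e p.1) - ∫ g, ψ g ∂(siteLaw (weightSpec φ') e p.2) ≤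
        (c e : ℝ) + ∑ y ∈ univ.erase e, (r e y : ℝ) * d y (p.1 y, p.2 y) + χ e p.1 + χ' e p.2) :
    ∃ Q : Measure ((V → G) × (V → G)), IsProbabilityMeasure Q ∧
      IsCoupling (weightMeasure φ) (weightMeasure φ') Q ∧
      ∀ e, ∫⁻ x, (d e (x.1 e, x.2 e) : ℝ≥0∞) ∂Q ≤
        c e + ∑ y ∈ univ.erase e, (r e y : ℝ≥0∞) * ∫⁻ x, (d y (x.1 y, x.2 y) : ℝ≥0∞) ∂Q +
          ∫⁻ ω, (χ e ω : ℝ≥0∞) ∂(weightMeasure φ) + ∫⁻ ω', (χ' e ω' : ℝ≥0∞) ∂(weightMeasure φ') := by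
  obtain ⟨a, ha⟩ := exists_abs_le_of_continuous hφc
  obtain ⟨a', ha'⟩ := exists_abs_le_of_continuous hφ'c
  have hφm : Measurable φ := hφc.measurable
  have hφ'm : Measurable φ' := hφ'c.measurable
  have hm : Measurable fun U : V → G => -φ U := hφm.neg
  have hm' : Measurable fun U : V → G => -φ' U := hφ'm.neg
  have hb : ∀ U : V → G, |(fun U => -φ U) U| ≤ a := fun U => by simpa [abs_neg] using ha U
  have hb' : ∀ U : V → G, |(fun U => -φ' U) U| ≤ a' := fun U => by simpa [abs_neg] using ha' U
  let K : V → (V → G) × (V → G) → ℝ≥0 := fun e p =>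
    c e + ∑ y ∈ univ.erase e, r e y * d y (p.1 y, p.2 y) + χ e p.1 + χ' e p.2
  have hKR : ∀ e p, (K e p : ℝ) =
      (c e : ℝ) + ∑ y ∈ univ.erase e, (r e y : ℝ) * d y (p.1 y, p.2 y) + χ e p.1 + χ' e p.2 := by
    intro e p
    simp only [K]
    push_cast
    rfl
  have hKE : ∀ e p, (K e p : ℝ≥0∞) =
      c e + ∑ y ∈ univ.erase e, (r e y : ℝ≥0∞) * d y (p.1 y, p.2 y) + χ e p.1 + χ' e p.2 := by
    intro e p
    simp only [K]
    push_cast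
    rfl
  have hK := exists_coupling_gibbsKernel_of_dual (haarProbability G) hm hb hm' hb' d hd0 hdsymm
    hdtri K (fun e p ψ hψ hL => by
      have h := hdual e p ψ hψ hL
      rw [siteLaw_weightSpec_eq_gibbsKernel hφm, siteLaw_weightSpec_eq_gibbsKernel hφ'm] at h
      exact h.trans_eq (hKR e p).symm)
  refine exists_isCoupling_le_of_defects_weightMeasure hφc hφ'c d c r χ χ' fun e p => ?_
  obtain ⟨π, hπ, hcpl, hle⟩ := hK e p
  refine ⟨π, hπ, ?_, hle.trans_eq (hKE e p)⟩
  rwa [siteLaw_weightSpec_eq_gibbsKernel hφm, siteLaw_weightSpec_eq_gibbsKernel hφ'm]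

end Defects

/-! ### Link level (Thm. 11.5.4.1, Cor. 11.5.4.2) -/

section Links

variable {V : Type*} [Fintype V] [DecidableEq V] [Nonempty V] {G : Type*} [Group G] [MetricSpace G]
  [IsTopologicalGroup G] [CompactSpace G] [MeasurableSpace G] [BorelSpace G]

/-- **Presutti 2009, Theorem 11.5.4.1 (link level), for two tilted Haar product laws from
POINTWISE one-link bounds with bad-set cut-offs.** `φ, φ'` continuous energies on `V → G`; bounded
continuous link costs `d_e ≥ 0`; if at every pair `(ω, ω')` some coupling of
`siteLaw (weightSpec φ) e ω`, `siteLaw (weightSpec φ') e ω'` has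
`∫ d_e ≤ c_e + Σ_{y ≠ e} θ(e,y) d_y(ω_y, ω'_y) + χ_e(ω) + χ'_e(ω')` and
`Σ_{y ≠ e} θ(e,y) e^{δ(e,y)} ≤ ρ < 1` for a pseudo-metric `δ` on links, then some coupling `Q` of
`weightMeasure φ`, `weightMeasure φ'` has, for every link `e`,
`E_Q d_e(U_e, U'_e) ≤ (1 − ρ)⁻¹ max_k e^{−δ(e,k)} (c_k + ∫ χ_k d(weightMeasure φ) + ∫ χ'_k d(weightMeasure φ'))`.
[cite: Presutti2009, §11.5.4 Thm. 11.5.4.1 with §11.5.6 «Conclusions»] -/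
theorem Presutti2009_thm_11_5_4_1_weightMeasure {φ φ' : (V → G) → ℝ} (hφc : Continuous φ)
    (hφ'c : Continuous φ') (d : V → (G × G) →ᵇ ℝ≥0) (c : V → ℝ≥0) (θ : V → V → ℝ≥0)
    (χ χ' : V → (V → G) →ᵇ ℝ≥0)
    (hK : ∀ e (p : (V → G) × (V → G)), ∃ π : Measure (G × G), IsProbabilityMeasure π ∧
      IsCoupling (siteLaw (weightSpec φ) e p.1) (siteLaw (weightSpec φ') e p.2) π ∧
      ∫⁻ s, (d e s : ℝ≥0∞) ∂π ≤
        c e + ∑ y ∈ univ.erase e, (θ e y : ℝ≥0∞) * d y (p.1 y, p.2 y) + χ e p.1 + χ' e p.2)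
    {δ : V → V → ℝ} (hδ0 : ∀ e, δ e e = 0) (hδ : ∀ e y, 0 ≤ δ e y)
    (htri : ∀ e y z, δ e z ≤ δ e y + δ y z) {ρ : ℝ} (hρ : ρ < 1)
    (hrow : ∀ e, ∑ y ∈ univ.erase e, (θ e y : ℝ) * Real.exp (δ e y) ≤ ρ) :
    ∃ Q : Measure ((V → G) × (V → G)), IsProbabilityMeasure Q ∧
      IsCoupling (weightMeasure φ) (weightMeasure φ') Q ∧
      ∀ e, ∫⁻ x, (d e (x.1 e, x.2 e) : ℝ≥0∞) ∂Q ≤ ENNReal.ofReal ((1 - ρ)⁻¹ *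
        univ.sup' ⟨e, mem_univ e⟩ (fun k => Real.exp (-δ e k) * ((c k : ℝ) +
          (∫⁻ ω, (χ k ω : ℝ≥0∞) ∂(weightMeasure φ)).toReal +
          (∫⁻ ω', (χ' k ω' : ℝ≥0∞) ∂(weightMeasure φ')).toReal))) := by
  obtain ⟨a, ha⟩ := exists_abs_le_of_continuous hφc
  obtain ⟨a', ha'⟩ := exists_abs_le_of_continuous hφ'c
  have hφm : Measurable φ := hφc.measurable
  have hφ'm : Measurable φ' := hφ'c.measurable
  have hm : Measurable fun U : V → G => -φ U := hφm.neg
  have hm' : Measurable fun U : V → G => -φ' U := hφ'm.neg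
  have hc : Continuous fun U : V → G => -φ U := hφc.neg
  have hc' : Continuous fun U : V → G => -φ' U := hφ'c.neg
  rw [weightMeasure_eq_gibbsMeasure φ, weightMeasure_eq_gibbsMeasure φ']
  refine Presutti2009_thm_11_5_4_1_gibbs_continuous (haarProbability G) (A := fun U => -φ U)
    (A' := fun U => -φ' U) hm hc (a := a) (fun U => by simpa [abs_neg] using ha U) hm' hc'
    (a' := a') (fun U => by simpa [abs_neg] using ha' U) d c θ χ χ' (fun e p => ?_)
    hδ0 hδ htri hρ hrow
  rw [← siteLaw_weightSpec_eq_gibbsKernel hφm, ← siteLaw_weightSpec_eq_gibbsKernel hφ'm]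
  exact hK e p

/-- **Presutti 2009, Corollary 11.5.4.2 (link level), same setting**: under the hypotheses of
`Presutti2009_thm_11_5_4_1_weightMeasure` with the one-link constants concentrated near a set `B`
of «boundary» links, `c_k ≤ D Σ_{j ∈ B} e^{−δ(k,j)}`, and uniformly small bad-set means
`∫ χ_k d(weightMeasure φ) + ∫ χ'_k d(weightMeasure φ') ≤ E`, every bounded measurable observable
with `|f(U) − f(U')| ≤ Σ_e L_e d_e(U_e, U'_e)` satisfies
`|∫ f d(weightMeasure φ) − ∫ f d(weightMeasure φ')| ≤ Σ_e L_e (1 − ρ)⁻¹ (D Σ_{j ∈ B} e^{−δ(e,j)} + E)`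
— (11.5.4.3) with the continuous-spin bad-set term `E`.
[cite: Presutti2009, §11.5.4 Cor. 11.5.4.2 (11.5.4.3)] -/
theorem Presutti2009_cor_11_5_4_2_weightMeasure {φ φ' : (V → G) → ℝ} (hφc : Continuous φ)
    (hφ'c : Continuous φ') (d : V → (G × G) →ᵇ ℝ≥0) (c : V → ℝ≥0) (θ : V → V → ℝ≥0)
    (χ χ' : V → (V → G) →ᵇ ℝ≥0)
    (hK : ∀ e (p : (V → G) × (V → G)), ∃ π : Measure (G × G), IsProbabilityMeasure π ∧
      IsCoupling (siteLaw (weightSpec φ) e p.1) (siteLaw (weightSpec φ') e p.2) π ∧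
      ∫⁻ s, (d e s : ℝ≥0∞) ∂π ≤
        c e + ∑ y ∈ univ.erase e, (θ e y : ℝ≥0∞) * d y (p.1 y, p.2 y) + χ e p.1 + χ' e p.2)
    {δ : V → V → ℝ} (hδ0 : ∀ e, δ e e = 0) (hδ : ∀ e y, 0 ≤ δ e y)
    (htri : ∀ e y z, δ e z ≤ δ e y + δ y z) {ρ : ℝ} (hρ : ρ < 1)
    (hrow : ∀ e, ∑ y ∈ univ.erase e, (θ e y : ℝ) * Real.exp (δ e y) ≤ ρ)
    (B : Finset V) {D E : ℝ} (hD : 0 ≤ D) (hcB : ∀ k, (c k : ℝ) ≤ D * ∑ j ∈ B, Real.exp (-δ k j))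
    (hE : ∀ k, (∫⁻ ω, (χ k ω : ℝ≥0∞) ∂(weightMeasure φ)).toReal +
      (∫⁻ ω', (χ' k ω' : ℝ≥0∞) ∂(weightMeasure φ')).toReal ≤ E)
    {f : (V → G) → ℝ} (hf : Measurable f) {M : ℝ} (hfM : ∀ U, |f U| ≤ M) (L : V → ℝ≥0)
    (hLip : ∀ U U', |f U - f U'| ≤ ∑ e, (L e : ℝ) * d e (U e, U' e)) :
    |∫ U, f U ∂(weightMeasure φ) - ∫ U', f U' ∂(weightMeasure φ')| ≤
      ∑ e, (L e : ℝ) * ((1 - ρ)⁻¹ * (D * ∑ j ∈ B, Real.exp (-δ e j) + E)) := by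
  obtain ⟨a, ha⟩ := exists_abs_le_of_continuous hφc
  obtain ⟨a', ha'⟩ := exists_abs_le_of_continuous hφ'c
  have hφm : Measurable φ := hφc.measurable
  have hφ'm : Measurable φ' := hφ'c.measurable
  have hm : Measurable fun U : V → G => -φ U := hφm.neg
  have hm' : Measurable fun U : V → G => -φ' U := hφ'm.neg
  have hc : Continuous fun U : V → G => -φ U := hφc.neg
  have hc' : Continuous fun U : V → G => -φ' U := hφ'c.neg
  rw [weightMeasure_eq_gibbsMeasure φ, weightMeasure_eq_gibbsMeasure φ'] at hE ⊢
  refine Presutti2009_cor_11_5_4_2_gibbs_continuous (haarProbability G) (A := fun U => -φ U)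
    (A' := fun U => -φ' U) hm hc (a := a) (fun U => by simpa [abs_neg] using ha U) hm' hc'
    (a' := a') (fun U => by simpa [abs_neg] using ha' U) d c θ χ χ' (fun e p => ?_)
    hδ0 hδ htri hρ hrow B hD hcB hE hf hfM L hLip
  rw [← siteLaw_weightSpec_eq_gibbsKernel hφm, ← siteLaw_weightSpec_eq_gibbsKernel hφ'm]
  exact hK e p

/-- **Presutti 2009, Corollary 11.5.4.2 (link level), from DUAL one-link bounds with bad-set
cut-offs**: as `Presutti2009_cor_11_5_4_2_weightMeasure`, with the one-link input in
Kantorovich–Rubinstein form — every `d_e` a continuous pseudo-metric on `G` and, for all `ψ` with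
`|ψ g − ψ h| ≤ d_e(g, h)`,
`∫ ψ d(siteLaw (weightSpec φ) e ω) − ∫ ψ d(siteLaw (weightSpec φ') e ω') ≤ c_e + Σ_{y ≠ e} θ(e,y) d_y(ω_y, ω'_y) + χ_e(ω) + χ'_e(ω')`.
[cite: Presutti2009, §11.5.4 Cor. 11.5.4.2 (11.5.4.3)] -/
theorem Presutti2009_cor_11_5_4_2_weightMeasure_of_dual {φ φ' : (V → G) → ℝ} (hφc : Continuous φ)
    (hφ'c : Continuous φ') (d : V → (G × G) →ᵇ ℝ≥0) (hd0 : ∀ e g, d e (g, g) = 0)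
    (hdsymm : ∀ e g h, d e (g, h) = d e (h, g))
    (hdtri : ∀ e g h k, d e (g, k) ≤ d e (g, h) + d e (h, k)) (c : V → ℝ≥0) (θ : V → V → ℝ≥0)
    (χ χ' : V → (V → G) →ᵇ ℝ≥0)
    (hdual : ∀ e (p : (V → G) × (V → G)) (ψ : G → ℝ), Continuous ψ →
      (∀ g h, |ψ g - ψ h| ≤ d e (g, h)) →
      ∫ g, ψ g ∂(siteLaw (weightSpec φ) e p.1) - ∫ g, ψ g ∂(siteLaw (weightSpec φ') e p.2) ≤
        (c e : ℝ) + ∑ y ∈ univ.erase e, (θ e y : ℝ) * d y (p.1 y, p.2 y) + χ e p.1 + χ' e p.2)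
    {δ : V → V → ℝ} (hδ0 : ∀ e, δ e e = 0) (hδ : ∀ e y, 0 ≤ δ e y)
    (htri : ∀ e y z, δ e z ≤ δ e y + δ y z) {ρ : ℝ} (hρ : ρ < 1)
    (hrow : ∀ e, ∑ y ∈ univ.erase e, (θ e y : ℝ) * Real.exp (δ e y) ≤ ρ)
    (B : Finset V) {D E : ℝ} (hD : 0 ≤ D) (hcB : ∀ k, (c k : ℝ) ≤ D * ∑ j ∈ B, Real.exp (-δ k j))
    (hE : ∀ k, (∫⁻ ω, (χ k ω : ℝ≥0∞) ∂(weightMeasure φ)).toReal +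
      (∫⁻ ω', (χ' k ω' : ℝ≥0∞) ∂(weightMeasure φ')).toReal ≤ E)
    {f : (V → G) → ℝ} (hf : Measurable f) {M : ℝ} (hfM : ∀ U, |f U| ≤ M) (L : V → ℝ≥0)
    (hLip : ∀ U U', |f U - f U'| ≤ ∑ e, (L e : ℝ) * d e (U e, U' e)) :
    |∫ U, f U ∂(weightMeasure φ) - ∫ U', f U' ∂(weightMeasure φ')| ≤
      ∑ e, (L e : ℝ) * ((1 - ρ)⁻¹ * (D * ∑ j ∈ B, Real.exp (-δ e j) + E)) := by
  obtain ⟨a, ha⟩ := exists_abs_le_of_continuous hφc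
  obtain ⟨a', ha'⟩ := exists_abs_le_of_continuous hφ'c
  have hφm : Measurable φ := hφc.measurable
  have hφ'm : Measurable φ' := hφ'c.measurable
  have hm : Measurable fun U : V → G => -φ U := hφm.neg
  have hm' : Measurable fun U : V → G => -φ' U := hφ'm.neg
  have hc : Continuous fun U : V → G => -φ U := hφc.neg
  have hc' : Continuous fun U : V → G => -φ' U := hφ'c.neg
  rw [weightMeasure_eq_gibbsMeasure φ, weightMeasure_eq_gibbsMeasure φ'] at hE ⊢
  refine Presutti2009_cor_11_5_4_2_gibbs_continuous_of_dual (haarProbability G)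
    (A := fun U => -φ U) (A' := fun U => -φ' U) hm hc (a := a)
    (fun U => by simpa [abs_neg] using ha U) hm' hc' (a' := a')
    (fun U => by simpa [abs_neg] using ha' U) d hd0 hdsymm hdtri c θ χ χ'
    (fun e p ψ hψ hL => ?_) hδ0 hδ htri hρ hrow B hD hcB hE hf hfM L hLip
  rw [← siteLaw_weightSpec_eq_gibbsKernel hφm, ← siteLaw_weightSpec_eq_gibbsKernel hφ'm]
  exact hdual e p ψ hψ hL

end Links

/-! ### Two scales (Thm. 11.5.4.1 from link-level data with Presutti's block parameters) -/

section TwoScale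

variable {V : Type*} [Fintype V] [DecidableEq V] [Nonempty V] {ι : Type*} [Fintype ι] [DecidableEq ι]
  {G : Type*} [Group G] [MetricSpace G] [IsTopologicalGroup G] [CompactSpace G] [MeasurableSpace G]
  [BorelSpace G]

/-- **Presutti 2009, Theorem 11.5.4.1 from link-level data, for two tilted Haar product laws.**
Links `V` grouped into blocks `C_i = b⁻¹{i}`; at every pair `(ω, ω')` some coupling of the one-link
laws `siteLaw (weightSpec φ) e ω`, `siteLaw (weightSpec φ') e ω'` has
`∫ d_e ≤ c_e + Σ_{y ≠ e} r(e,y) d_y(ω_y, ω'_y) + χ_e(ω) + χ'_e(ω')` ((11.5.6.7)); Presutti's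
parameters (11.5.3.8)–(11.5.3.9): in-block rows `≤ R₀(b e) < 1`, block-to-block rows `≤ R(b e, j)`,
block constants `c_e + ⟨χ_e⟩ + ⟨χ'_e⟩ ≤ A(b e)`, and (11.5.4.1) for `θ(i,j) = (1 − R₀(i))⁻¹ R(i,j)`.
Conclusion: a coupling `Q` of `weightMeasure φ`, `weightMeasure φ'` with, for every link `e`,
`E_Q d_e(U_e, U'_e) ≤ (1 − ρ)⁻¹ max_k e^{−δ(b e, k)} (1 − R₀(k))⁻¹ A(k)`.
[cite: Presutti2009, §11.5.4 Thm. 11.5.4.1 with §11.5.6 (11.5.6.7)–(11.5.6.11) and «Conclusions»] -/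
theorem Presutti2009_thm_11_5_4_1_sites_weightMeasure {φ φ' : (V → G) → ℝ} (hφc : Continuous φ)
    (hφ'c : Continuous φ') (d : V → (G × G) →ᵇ ℝ≥0) (c : V → ℝ≥0) (r : V → V → ℝ≥0)
    (χ χ' : V → (V → G) →ᵇ ℝ≥0)
    (hK : ∀ e (p : (V → G) × (V → G)), ∃ π : Measure (G × G), IsProbabilityMeasure π ∧
      IsCoupling (siteLaw (weightSpec φ) e p.1) (siteLaw (weightSpec φ') e p.2) π ∧
      ∫⁻ s, (d e s : ℝ≥0∞) ∂π ≤
        c e + ∑ y ∈ univ.erase e, (r e y : ℝ≥0∞) * d y (p.1 y, p.2 y) + χ e p.1 + χ' e p.2)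
    (b : V → ι) (hb : Function.Surjective b) {R₀ : ι → ℝ} (hR₀ : ∀ i, R₀ i < 1)
    {R : ι → ι → ℝ} (hR : ∀ i j, 0 ≤ R i j)
    (hin : ∀ e, ∑ y ∈ (univ.erase e).filter (fun y => b y = b e), (r e y : ℝ) ≤ R₀ (b e))
    (hout : ∀ e j, j ≠ b e →
      ∑ y ∈ (univ.erase e).filter (fun y => b y = j), (r e y : ℝ) ≤ R (b e) j)
    {Ab : ι → ℝ} (hA : ∀ e, (c e : ℝ) + (∫⁻ ω, (χ e ω : ℝ≥0∞) ∂(weightMeasure φ)).toReal +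
      (∫⁻ ω', (χ' e ω' : ℝ≥0∞) ∂(weightMeasure φ')).toReal ≤ Ab (b e))
    {δ : ι → ι → ℝ} (hδ0 : ∀ i, δ i i = 0) (hδ : ∀ i j, 0 ≤ δ i j)
    (htri : ∀ i j k, δ i k ≤ δ i j + δ j k) {ρ : ℝ} (hρ : ρ < 1)
    (hrowB : ∀ i, ∑ j ∈ univ.erase i, ((1 - R₀ i)⁻¹ * R i j) * Real.exp (δ i j) ≤ ρ) :
    ∃ Q : Measure ((V → G) × (V → G)), IsProbabilityMeasure Q ∧
      IsCoupling (weightMeasure φ) (weightMeasure φ') Q ∧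
      ∀ e, ∫⁻ p, (d e (p.1 e, p.2 e) : ℝ≥0∞) ∂Q ≤ ENNReal.ofReal ((1 - ρ)⁻¹ *
        univ.sup' ⟨b e, mem_univ _⟩
          (fun k => Real.exp (-δ (b e) k) * ((1 - R₀ k)⁻¹ * Ab k))) := by
  obtain ⟨a, ha⟩ := exists_abs_le_of_continuous hφc
  obtain ⟨a', ha'⟩ := exists_abs_le_of_continuous hφ'c
  have hφm : Measurable φ := hφc.measurable
  have hφ'm : Measurable φ' := hφ'c.measurable
  have hm : Measurable fun U : V → G => -φ U := hφm.neg
  have hm' : Measurable fun U : V → G => -φ' U := hφ'm.neg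
  have hc : Continuous fun U : V → G => -φ U := hφc.neg
  have hc' : Continuous fun U : V → G => -φ' U := hφ'c.neg
  rw [weightMeasure_eq_gibbsMeasure φ, weightMeasure_eq_gibbsMeasure φ'] at hA ⊢
  refine Presutti2009_thm_11_5_4_1_sites_gibbs_continuous (haarProbability G)
    (A := fun U => -φ U) (A' := fun U => -φ' U) hm hc (a := a)
    (fun U => by simpa [abs_neg] using ha U) hm' hc' (a' := a')
    (fun U => by simpa [abs_neg] using ha' U) d c r χ χ' (fun e p => ?_) b hb hR₀ hR hin hout hA
    hδ0 hδ htri hρ hrowB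
  rw [← siteLaw_weightSpec_eq_gibbsKernel hφm, ← siteLaw_weightSpec_eq_gibbsKernel hφ'm]
  exact hK e p

/-- **The same from DUAL link-level bounds with bad-set cut-offs** (every `d_e` a continuous
pseudo-metric; for all `ψ` with `|ψ g − ψ h| ≤ d_e(g, h)`,
`∫ ψ d(siteLaw (weightSpec φ) e ω) − ∫ ψ d(siteLaw (weightSpec φ') e ω') ≤ c_e + Σ_{y ≠ e} r(e,y) d_y(ω_y, ω'_y) + χ_e(ω) + χ'_e(ω')`).
[cite: Presutti2009, §11.5.4 Thm. 11.5.4.1 with §11.5.6 (11.5.6.7)–(11.5.6.11) and «Conclusions»] -/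
theorem Presutti2009_thm_11_5_4_1_sites_weightMeasure_of_dual {φ φ' : (V → G) → ℝ}
    (hφc : Continuous φ) (hφ'c : Continuous φ') (d : V → (G × G) →ᵇ ℝ≥0)
    (hd0 : ∀ e g, d e (g, g) = 0) (hdsymm : ∀ e g h, d e (g, h) = d e (h, g))
    (hdtri : ∀ e g h k, d e (g, k) ≤ d e (g, h) + d e (h, k)) (c : V → ℝ≥0) (r : V → V → ℝ≥0)
    (χ χ' : V → (V → G) →ᵇ ℝ≥0)
    (hdual : ∀ e (p : (V → G) × (V → G)) (ψ : G → ℝ), Continuous ψ →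
      (∀ g h, |ψ g - ψ h| ≤ d e (g, h)) →
      ∫ g, ψ g ∂(siteLaw (weightSpec φ) e p.1) - ∫ g, ψ g ∂(siteLaw (weightSpec φ') e p.2) ≤
        (c e : ℝ) + ∑ y ∈ univ.erase e, (r e y : ℝ) * d y (p.1 y, p.2 y) + χ e p.1 + χ' e p.2)
    (b : V → ι) (hb : Function.Surjective b) {R₀ : ι → ℝ} (hR₀ : ∀ i, R₀ i < 1)
    {R : ι → ι → ℝ} (hR : ∀ i j, 0 ≤ R i j)
    (hin : ∀ e, ∑ y ∈ (univ.erase e).filter (fun y => b y = b e), (r e y : ℝ) ≤ R₀ (b e))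
    (hout : ∀ e j, j ≠ b e →
      ∑ y ∈ (univ.erase e).filter (fun y => b y = j), (r e y : ℝ) ≤ R (b e) j)
    {Ab : ι → ℝ} (hA : ∀ e, (c e : ℝ) + (∫⁻ ω, (χ e ω : ℝ≥0∞) ∂(weightMeasure φ)).toReal +
      (∫⁻ ω', (χ' e ω' : ℝ≥0∞) ∂(weightMeasure φ')).toReal ≤ Ab (b e))
    {δ : ι → ι → ℝ} (hδ0 : ∀ i, δ i i = 0) (hδ : ∀ i j, 0 ≤ δ i j)
    (htri : ∀ i j k, δ i k ≤ δ i j + δ j k) {ρ : ℝ} (hρ : ρ < 1)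
    (hrowB : ∀ i, ∑ j ∈ univ.erase i, ((1 - R₀ i)⁻¹ * R i j) * Real.exp (δ i j) ≤ ρ) :
    ∃ Q : Measure ((V → G) × (V → G)), IsProbabilityMeasure Q ∧
      IsCoupling (weightMeasure φ) (weightMeasure φ') Q ∧
      ∀ e, ∫⁻ p, (d e (p.1 e, p.2 e) : ℝ≥0∞) ∂Q ≤ ENNReal.ofReal ((1 - ρ)⁻¹ *
        univ.sup' ⟨b e, mem_univ _⟩
          (fun k => Real.exp (-δ (b e) k) * ((1 - R₀ k)⁻¹ * Ab k))) := by
  obtain ⟨a, ha⟩ := exists_abs_le_of_continuous hφc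
  obtain ⟨a', ha'⟩ := exists_abs_le_of_continuous hφ'c
  have hφm : Measurable φ := hφc.measurable
  have hφ'm : Measurable φ' := hφ'c.measurable
  have hm : Measurable fun U : V → G => -φ U := hφm.neg
  have hm' : Measurable fun U : V → G => -φ' U := hφ'm.neg
  have hc : Continuous fun U : V → G => -φ U := hφc.neg
  have hc' : Continuous fun U : V → G => -φ' U := hφ'c.neg
  rw [weightMeasure_eq_gibbsMeasure φ, weightMeasure_eq_gibbsMeasure φ'] at hA ⊢
  refine Presutti2009_thm_11_5_4_1_sites_gibbs_continuous_of_dual (haarProbability G)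
    (A := fun U => -φ U) (A' := fun U => -φ' U) hm hc (a := a)
    (fun U => by simpa [abs_neg] using ha U) hm' hc' (a' := a')
    (fun U => by simpa [abs_neg] using ha' U) d hd0 hdsymm hdtri c r χ χ'
    (fun e p ψ hψ hL => ?_) b hb hR₀ hR hin hout hA hδ0 hδ htri hρ hrowB
  rw [← siteLaw_weightSpec_eq_gibbsKernel hφm, ← siteLaw_weightSpec_eq_gibbsKernel hφ'm]
  exact hdual e p ψ hψ hL

end TwoScale

end Literature.MathematicalPhysics.QuantumFieldTheory.Balaban1983to89.StrongCouplingOpenWindow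

end

/-!
# Part III — Dobrushin couplings in TOTAL-VARIATION currency for two tilted Haar product laws
# (`weightMeasure φ`, `weightMeasure φ'`) from one-link ENERGY OSCILLATION rows

Presutti 2009 [Presutti2009], §3.2.2 Cor. 3.2.2.2 and §11.5.4 Thm. 11.5.4.1 / Cor. 11.5.4.2 with the
MAXIMAL one-site couplings of §3.2.3 Thm. 3.2.3.1 (the discrete cost `𝟙{s ≠ s'}`, i.e. the printed
currency of §11.5), for the objects of this directory: `weightMeasure φ = (⊗_{e ∈ V} Haar).tilted φ`
on `V → G` (`V` a finite link set, `G` a compact metric group), which by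
`WeightSpecDobrushinCoupling.weightMeasure_eq_gibbsMeasure` is the T4 Gibbs law of the energy `−φ`.
The one-link input is given in ENERGY form — the Dobrushin row in TV currency
(`DobrushinCouplingGibbsTV.one_sub_commonMass_tvDensity_le_two_mul`: an oscillation bound
`|φ(ω[e↦g]) − φ'(ω'[e↦g])| ≤ δ ∀ g` gives one-link TV defect `≤ 1 − e^{−2δ} ≤ 2δ`):

* `Presutti2009_cor_3_2_2_2_weightMeasure_tv` — if for every link `e`, pair `(ω, ω')` and `g ∈ G`,
  `2|φ(ω[e↦g]) − φ'(ω'[e↦g])| ≤ C_e + Σ_{y ≠ e} r(e,y) 𝟙{ω_y ≠ ω'_y} + χ_e(ω) + χ'_e(ω')` (measurable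
  cut-offs `χ, χ'` for bad sets), then some coupling `Q` of `weightMeasure φ`, `weightMeasure φ'` has
  `Q{U_e ≠ U'_e} ≤ C_e + Σ_{y ≠ e} r(e,y) Q{U_y ≠ U'_y} + ⟨χ_e⟩_φ + ⟨χ'_e⟩_{φ'}`;
* `Presutti2009_thm_11_5_4_1_weightMeasure_tv_sites` — the two-scale (link → block) decay profile
  (11.5.4.2) for `Q{U_e ≠ U'_e}` under Presutti's block parameters and (11.5.4.1);
* `Presutti2009_cor_11_5_4_2_weightMeasure_tv` — (11.5.4.3): `|⟨f⟩_φ − ⟨f⟩_{φ'}| ≤ Σ_e L_e (1 − κ)⁻¹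
  (D Σ_{j ∈ B} e^{−δ(e,j)} + E)` for `|f(U) − f(U')| ≤ Σ_e L_e 𝟙{U_e ≠ U'_e}`.

Scope (honest): finite `V`, compact metric group `G`, continuous energies; the oscillation rows are
hypotheses (for a model: its interaction ranges and, for `φ ≠ φ'`, the one-link energy difference);
bad sets cost their probability ADDITIVELY (no Dobrushin–Pechersky rate). No named facts.

## References
* E. Presutti, *Scaling Limits in Statistical Mechanics and Microstructures in Continuum Mechanics*
  (Springer 2009), §3.2.2 Cor. 3.2.2.2; §3.2.3 Thm. 3.2.3.1, Cor. 3.2.3.2; §11.5.4 Thm. 11.5.4.1,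
  Cor. 11.5.4.2; §11.5.6 «Conclusions». [Presutti2009]
* S. Friedli, Y. Velenik, *Statistical Mechanics of Lattice Systems* (CUP 2017), §6.10.2 (6.110),
  Lemma 6.28. [FriedliVelenik2017]
-/

noncomputable section

open MeasureTheory ProbabilityTheory Function Finset
open scoped ENNReal NNReal BoundedContinuousFunction
open Literature.Probability.LatticeModels
open Literature.Probability.LatticeModels.DobrushinMetric

namespace Literature.MathematicalPhysics.QuantumFieldTheory.Balaban1983to89.StrongCouplingOpenWindow

open Literature.MathematicalPhysics.QuantumFieldTheory
open Literature.MeasureTheory.OptimalTransport (IsCoupling)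
open Literature.MathematicalPhysics.QuantumFieldTheory.Balaban1983to89.T4DobrushinTensorisation
  (gibbsMeasure gibbsKernel)
open Literature.Probability.TransportMaps.TVDisagreement (tvCost)
open Literature.Probability.TransportMaps.DobrushinCouplingGibbsTV
open Literature.Probability.TransportMaps.MaximalCouplingKernel (commonMass)

variable {V : Type*} [Fintype V] [DecidableEq V] [Nonempty V] {G : Type*} [Group G] [MetricSpace G]
  [IsTopologicalGroup G] [CompactSpace G] [MeasurableSpace G] [BorelSpace G]

omit [Fintype V] [Nonempty V] [IsTopologicalGroup G] [MeasurableSpace G] [BorelSpace G] in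
/-- From a pointwise oscillation row for every `g ∈ G` to the one-link TV row: the maximum of the
continuous function `g ↦ |φ(ω[e↦g]) − φ'(ω'[e↦g])|` on the compact group realises `δ`.
[cite: Presutti2009, §3.2.3 Cor. 3.2.3.2, p. 116] -/
private theorem exists_delta_of_forall {φ φ' : (V → G) → ℝ} (hφc : Continuous φ)
    (hφ'c : Continuous φ') (e : V) (p : (V → G) × (V → G)) :
    ∃ g₀ : G, ∀ g, |(fun U => -φ U) (update p.1 e g) - (fun U => -φ' U) (update p.2 e g)| ≤
      |φ (update p.1 e g₀) - φ' (update p.2 e g₀)| := by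
  have hF : Continuous fun g : G => |φ (update p.1 e g) - φ' (update p.2 e g)| :=
    ((hφc.comp (continuous_const.update e continuous_id)).sub
      (hφ'c.comp (continuous_const.update e continuous_id))).abs
  obtain ⟨g₀, -, hg₀⟩ := isCompact_univ.exists_isMaxOn Set.univ_nonempty hF.continuousOn
  refine ⟨g₀, fun g => ?_⟩
  have h := hg₀ (Set.mem_univ g)
  simp only at h
  calc |(-φ (update p.1 e g)) - (-φ' (update p.2 e g))|
      = |φ (update p.1 e g) - φ' (update p.2 e g)| := by
        rw [show -φ (update p.1 e g) - -φ' (update p.2 e g) =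
          -(φ (update p.1 e g) - φ' (update p.2 e g)) by ring, abs_neg]
    _ ≤ _ := h

omit [Nonempty V] in
/-- The TV rows `hK` of `DobrushinCouplingGibbsTV` for the energies `−φ`, `−φ'` from ENERGY
OSCILLATION rows. [cite: Presutti2009, §3.2.3 Cor. 3.2.3.2, p. 116; FriedliVelenik2017, Lemma 6.28] -/
theorem tvRow_of_oscillation {φ φ' : (V → G) → ℝ} (hφc : Continuous φ) (hφ'c : Continuous φ')
    {a a' : ℝ} (ha : ∀ U, |(fun U => -φ U) U| ≤ a) (ha' : ∀ U, |(fun U => -φ' U) U| ≤ a')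
    (C : V → ℝ≥0∞) (r : V → V → ℝ≥0∞) (χ χ' : V → (V → G) → ℝ≥0∞)
    (hosc : ∀ e (p : (V → G) × (V → G)) (g : G),
      ENNReal.ofReal (2 * |φ (update p.1 e g) - φ' (update p.2 e g)|) ≤
        C e + ∑ y ∈ univ.erase e, r e y * tvCost G (p.1 y, p.2 y) + χ e p.1 + χ' e p.2)
    (e : V) (p : (V → G) × (V → G)) :
    1 - commonMass (haarProbability G)
        (fun (p : (V → G) × (V → G)) s => tvDensity (haarProbability G) (fun U => -φ U) e p.1 s)
        (fun p s => tvDensity (haarProbability G) (fun U => -φ' U) e p.2 s) p ≤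
      C e + ∑ y ∈ univ.erase e, r e y * tvCost G (p.1 y, p.2 y) + χ e p.1 + χ' e p.2 := by
  obtain ⟨g₀, hg₀⟩ := exists_delta_of_forall hφc hφ'c e p
  obtain ⟨ω, ω'⟩ := p
  exact (one_sub_commonMass_tvDensity_le_two_mul (ν := haarProbability G) hφc.measurable.neg ha
    hφ'c.measurable.neg ha' e hg₀).trans (hosc e (ω, ω') g₀)

/-- **Presutti 2009, Cor. 3.2.2.2 in TV currency for two tilted Haar product laws, from energy
oscillation rows.** `V` finite, `G` compact metric group, `φ, φ'` continuous energies; if for every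
link `e`, every pair of configurations and every `g`,
`2|φ(ω[e↦g]) − φ'(ω'[e↦g])| ≤ C_e + Σ_{y ≠ e} r(e,y) 𝟙{ω_y ≠ ω'_y} + χ_e(ω) + χ'_e(ω')` (measurable
bad-set cut-offs), then there is a coupling `Q` of `weightMeasure φ`, `weightMeasure φ'` with
`Q{U_e ≠ U'_e} ≤ C_e + Σ_{y ≠ e} r(e,y) Q{U_y ≠ U'_y} + ∫ χ_e d(weightMeasure φ) + ∫ χ'_e d(weightMeasure φ')`.
[cite: Presutti2009, §3.2.2 Cor. 3.2.2.2 (p. 115) with §3.2.3 Thm. 3.2.3.1, Cor. 3.2.3.2 (p. 116)] -/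
theorem Presutti2009_cor_3_2_2_2_weightMeasure_tv {φ φ' : (V → G) → ℝ} (hφc : Continuous φ)
    (hφ'c : Continuous φ') (C : V → ℝ≥0∞) (r : V → V → ℝ≥0∞) (χ χ' : V → (V → G) → ℝ≥0∞)
    (hχ : ∀ e, Measurable (χ e)) (hχ' : ∀ e, Measurable (χ' e))
    (hosc : ∀ e (p : (V → G) × (V → G)) (g : G),
      ENNReal.ofReal (2 * |φ (update p.1 e g) - φ' (update p.2 e g)|) ≤
        C e + ∑ y ∈ univ.erase e, r e y * tvCost G (p.1 y, p.2 y) + χ e p.1 + χ' e p.2) :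
    ∃ Q : Measure ((V → G) × (V → G)), IsProbabilityMeasure Q ∧
      IsCoupling (weightMeasure φ) (weightMeasure φ') Q ∧
      ∀ e, Q {x | x.1 e ≠ x.2 e} ≤
        C e + ∑ y ∈ univ.erase e, r e y * Q {x | x.1 y ≠ x.2 y} +
          ∫⁻ U, χ e U ∂(weightMeasure φ) + ∫⁻ U', χ' e U' ∂(weightMeasure φ') := by
  obtain ⟨a, ha⟩ := exists_abs_le_of_continuous hφc
  obtain ⟨a', ha'⟩ := exists_abs_le_of_continuous hφ'c
  have hb : ∀ U, |(fun U => -φ U) U| ≤ a := fun U => by simpa [abs_neg] using ha U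
  have hb' : ∀ U, |(fun U => -φ' U) U| ≤ a' := fun U => by simpa [abs_neg] using ha' U
  rw [weightMeasure_eq_gibbsMeasure φ, weightMeasure_eq_gibbsMeasure φ']
  obtain ⟨Q, hQ, hcpl, -, hv⟩ := Presutti2009_cor_3_2_2_2_gibbs_tv (ν := haarProbability G)
    (A := fun U => -φ U) (A' := fun U => -φ' U) hφc.measurable.neg hφc.neg hb hφ'c.measurable.neg
    hφ'c.neg hb' C r χ χ' hχ hχ' (tvRow_of_oscillation hφc hφ'c hb hb' C r χ χ' hosc)
  exact ⟨Q, hQ, hcpl, hv⟩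

/-- **Presutti 2009, Thm. 11.5.4.1 in TV currency for two tilted Haar product laws, from
link-level energy oscillation rows (two scales).** Links grouped into blocks by `b : V → Λ` (onto);
oscillation rows as in `Presutti2009_cor_3_2_2_2_weightMeasure_tv` with `ℝ≥0` constants; Presutti's
block parameters (11.5.3.8) `R₀ < 1`, `R`, block constants `C_e + ⟨χ_e⟩ + ⟨χ'_e⟩ ≤ A(b e)`, and
(11.5.4.1) `Σ_{l ≠ k} (1 − R₀(k))⁻¹ R(k,l) e^{δ(k,l)} ≤ κ < 1`. CONCLUSION: a coupling `Q` of
`weightMeasure φ`, `weightMeasure φ'` with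
`Q{U_e ≠ U'_e} ≤ (1 − κ)⁻¹ max_k e^{−δ(b e, k)} (1 − R₀(k))⁻¹ A(k)` for every link `e`.
[cite: Presutti2009, §11.5.4 Thm. 11.5.4.1 with §11.5.6 (11.5.6.7)–(11.5.6.11) and «Conclusions»] -/
theorem Presutti2009_thm_11_5_4_1_weightMeasure_tv_sites {Λ : Type*} [Fintype Λ] [DecidableEq Λ]
    {φ φ' : (V → G) → ℝ} (hφc : Continuous φ) (hφ'c : Continuous φ')
    (C : V → ℝ≥0) (r : V → V → ℝ≥0) (χ χ' : V → (V → G) → ℝ≥0∞)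
    (hχ : ∀ e, Measurable (χ e)) (hχ' : ∀ e, Measurable (χ' e))
    (hχfin : ∀ e, ∫⁻ U, χ e U ∂(weightMeasure φ) ≠ ∞)
    (hχ'fin : ∀ e, ∫⁻ U', χ' e U' ∂(weightMeasure φ') ≠ ∞)
    (hosc : ∀ e (p : (V → G) × (V → G)) (g : G),
      ENNReal.ofReal (2 * |φ (update p.1 e g) - φ' (update p.2 e g)|) ≤
        C e + ∑ y ∈ univ.erase e, (r e y : ℝ≥0∞) * tvCost G (p.1 y, p.2 y) + χ e p.1 + χ' e p.2)
    (b : V → Λ) (hb : Function.Surjective b) {R₀ : Λ → ℝ} (hR₀ : ∀ k, R₀ k < 1)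
    {R : Λ → Λ → ℝ} (hR : ∀ k l, 0 ≤ R k l)
    (hin : ∀ x, ∑ y ∈ (univ.erase x).filter (fun y => b y = b x), (r x y : ℝ) ≤ R₀ (b x))
    (hout : ∀ x l, l ≠ b x →
      ∑ y ∈ (univ.erase x).filter (fun y => b y = l), (r x y : ℝ) ≤ R (b x) l)
    {A : Λ → ℝ} (hA : ∀ x, (C x : ℝ) + (∫⁻ U, χ x U ∂(weightMeasure φ)).toReal +
      (∫⁻ U', χ' x U' ∂(weightMeasure φ')).toReal ≤ A (b x))
    {δ : Λ → Λ → ℝ} (hδ0 : ∀ k, δ k k = 0) (hδ : ∀ k l, 0 ≤ δ k l)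
    (htri : ∀ k l m, δ k m ≤ δ k l + δ l m) {κ : ℝ} (hκ : κ < 1)
    (hrowB : ∀ k, ∑ l ∈ univ.erase k, ((1 - R₀ k)⁻¹ * R k l) * Real.exp (δ k l) ≤ κ) :
    ∃ Q : Measure ((V → G) × (V → G)), IsProbabilityMeasure Q ∧
      IsCoupling (weightMeasure φ) (weightMeasure φ') Q ∧
      ∀ x, Q {p | p.1 x ≠ p.2 x} ≤ ENNReal.ofReal ((1 - κ)⁻¹ *
        univ.sup' ⟨b x, mem_univ _⟩
          (fun k => Real.exp (-δ (b x) k) * ((1 - R₀ k)⁻¹ * A k))) := by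
  obtain ⟨a, ha⟩ := exists_abs_le_of_continuous hφc
  obtain ⟨a', ha'⟩ := exists_abs_le_of_continuous hφ'c
  have hb1 : ∀ U, |(fun U => -φ U) U| ≤ a := fun U => by simpa [abs_neg] using ha U
  have hb1' : ∀ U, |(fun U => -φ' U) U| ≤ a' := fun U => by simpa [abs_neg] using ha' U
  rw [weightMeasure_eq_gibbsMeasure φ] at hχfin hA ⊢
  rw [weightMeasure_eq_gibbsMeasure φ'] at hχ'fin hA ⊢
  obtain ⟨Q, hQ, hcpl, -, hv⟩ := Presutti2009_thm_11_5_4_1_gibbs_tv_sites (ν := haarProbability G)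
    (A := fun U => -φ U) (A' := fun U => -φ' U) hφc.measurable.neg hφc.neg hb1
    hφ'c.measurable.neg hφ'c.neg hb1' C r χ χ' hχ hχ' hχfin hχ'fin
    (tvRow_of_oscillation hφc hφ'c hb1 hb1' (fun e => (C e : ℝ≥0∞)) (fun e y => (r e y : ℝ≥0∞))
      χ χ' hosc) b hb hR₀ hR hin hout hA hδ0 hδ htri hκ hrowB
  exact ⟨Q, hQ, hcpl, hv⟩

/-- **Presutti 2009, Cor. 11.5.4.2 in TV currency for two tilted Haar product laws** (comparison
of expectations from energy oscillation rows): with (11.5.4.1) at link level, constants concentrated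
near `B` (`C_k ≤ D Σ_{j ∈ B} e^{−δ(k,j)}`), bad-set means `≤ E`, every bounded measurable `f` with
`|f(U) − f(U')| ≤ Σ_e L_e 𝟙{U_e ≠ U'_e}` has `|⟨f⟩_φ − ⟨f⟩_{φ'}| ≤ Σ_e L_e (1 − κ)⁻¹ (D Σ_{j∈B} e^{−δ(e,j)} + E)`.
[cite: Presutti2009, §11.5.4 Cor. 11.5.4.2 (11.5.4.3)] -/
theorem Presutti2009_cor_11_5_4_2_weightMeasure_tv {φ φ' : (V → G) → ℝ} (hφc : Continuous φ)
    (hφ'c : Continuous φ') (C : V → ℝ≥0) (θ : V → V → ℝ≥0) (χ χ' : V → (V → G) → ℝ≥0∞)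
    (hχ : ∀ e, Measurable (χ e)) (hχ' : ∀ e, Measurable (χ' e))
    (hχfin : ∀ e, ∫⁻ U, χ e U ∂(weightMeasure φ) ≠ ∞)
    (hχ'fin : ∀ e, ∫⁻ U', χ' e U' ∂(weightMeasure φ') ≠ ∞)
    (hosc : ∀ e (p : (V → G) × (V → G)) (g : G),
      ENNReal.ofReal (2 * |φ (update p.1 e g) - φ' (update p.2 e g)|) ≤
        C e + ∑ y ∈ univ.erase e, (θ e y : ℝ≥0∞) * tvCost G (p.1 y, p.2 y) + χ e p.1 + χ' e p.2)
    {δ : V → V → ℝ} (hδ0 : ∀ e, δ e e = 0) (hδ : ∀ e y, 0 ≤ δ e y)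
    (htri : ∀ e y z, δ e z ≤ δ e y + δ y z) {κ : ℝ} (hκ : κ < 1)
    (hrow : ∀ e, ∑ y ∈ univ.erase e, (θ e y : ℝ) * Real.exp (δ e y) ≤ κ)
    (B : Finset V) {D E : ℝ} (hD : 0 ≤ D) (hcB : ∀ k, (C k : ℝ) ≤ D * ∑ j ∈ B, Real.exp (-δ k j))
    (hE : ∀ k, (∫⁻ U, χ k U ∂(weightMeasure φ)).toReal +
      (∫⁻ U', χ' k U' ∂(weightMeasure φ')).toReal ≤ E)
    {f : (V → G) → ℝ} (hf : Measurable f) {M : ℝ} (hfM : ∀ U, |f U| ≤ M) (L : V → ℝ≥0)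
    (hLip : ∀ U U', |f U - f U'| ≤ ∑ e, (L e : ℝ) * (tvCost G (U e, U' e)).toReal) :
    |∫ U, f U ∂(weightMeasure φ) - ∫ U', f U' ∂(weightMeasure φ')| ≤
      ∑ e, (L e : ℝ) * ((1 - κ)⁻¹ * (D * ∑ j ∈ B, Real.exp (-δ e j) + E)) := by
  obtain ⟨a, ha⟩ := exists_abs_le_of_continuous hφc
  obtain ⟨a', ha'⟩ := exists_abs_le_of_continuous hφ'c
  have hb1 : ∀ U, |(fun U => -φ U) U| ≤ a := fun U => by simpa [abs_neg] using ha U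
  have hb1' : ∀ U, |(fun U => -φ' U) U| ≤ a' := fun U => by simpa [abs_neg] using ha' U
  rw [weightMeasure_eq_gibbsMeasure φ] at hχfin hE ⊢
  rw [weightMeasure_eq_gibbsMeasure φ'] at hχ'fin hE ⊢
  exact Presutti2009_cor_11_5_4_2_gibbs_tv (ν := haarProbability G) (A := fun U => -φ U)
    (A' := fun U => -φ' U) hφc.measurable.neg hφc.neg hb1 hφ'c.measurable.neg hφ'c.neg hb1'
    C θ χ χ' hχ hχ' hχfin hχ'fin
    (tvRow_of_oscillation hφc hφ'c hb1 hb1' (fun e => (C e : ℝ≥0∞)) (fun e y => (θ e y : ℝ≥0∞))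
      χ χ' hosc) hδ0 hδ htri hκ hrow B hD hcB hE hf hfM L hLip

end Literature.MathematicalPhysics.QuantumFieldTheory.Balaban1983to89.StrongCouplingOpenWindow

end
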